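import Summits.Parity.GeneralizedHardyLittlewood.Theorems.LeeYangFibresAbsoluteUpgradeUniformDefs
import Summits.Parity.GeneralizedHardyLittlewood.Theorems.LeeYangFibresRelativeDimOneLocalAverage
import Literature.NumberTheory.Sieve.GallagherSingularSeries
import HarnessLib

/-!
# Route `LeeYangFibres`, crux `AbsoluteUpgrade` (stmt-Parity-14116), line `Sketch` (uniform amplification):
# B = `CondLocalAverage`, Gallagher's exact Chinese-remainder average with collision conditions

For disjoint finite sets of primes `S`, `Q`, an assignment `α` of a collision index `((j,j'),(i,i'))` with
`j ≠ j'` to every prime `p ∈ Q` (with `p ∤ a_i` for all `i`), and ANY integer box of side `P = ∏_{S ∪ Q} p`,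

  `∑_{H ∈ box} (∏_{p ∈ S} β_p(Ψ^{(H)})) ∏_{p ∈ Q} 1[p ∣ Δ_{α(p)}(H)] = P^m (∏_{p ∈ S} β_p(Ψ)^{m+1}) / ∏_Q p`

(`stub_condLocalAverage : CondLocalAverage`, the registered stub B of the skeleton
`Cruxes/AbsoluteUpgrade/Lines/Sketch.lean`; `Q = ∅` is the landed `stub_localAverage`).

## Proof

All steps are exact identities.
1. Periodicity: `β_p(Ψ^{(H)})` (`localFactor_translateFamily_congr`) and the collision indicator
   `1[p ∣ Δ(H)]` (`collisionForm_modEq`: `Δ` is integer-affine in `H`) depend only on `H mod p`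
   coordinatewise; so the summand is `P`-periodic and the box may be replaced by `[0, P)^m ⊆ ℕ^m`
   (`sum_box_eq_sum_range_of_periodic`).
2. Chinese remainder theorem over `S ∪ Q` (`sum_prod_eq_prod_sum_of_periodic`, induction on the set of
   primes with the fibre lemma `Gallagher.sum_filter_modVec_eq`): the sum factorises as
   `∏_{p ∈ S} [∑_{v ∈ [0,p)^m} β_p(Ψ^{(v)})] · ∏_{p ∈ Q} #{v ∈ [0,p)^m : p ∣ Δ_{α(p)}(v)}`.
3. The factors: `∑_{v} β_p(Ψ^{(v)}) = p^m β_p(Ψ)^{m+1}` is the landed `sum_localFactor_translateFamily`;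
   and `#{v ∈ [0,p)^m : p ∣ Δ_{j,j',i,i'}(v)} = p^{m-1}` for `j ≠ j'`, `p ∤ a_i a_{i'}`
   (`sum_collisionIndicator`): one of `j, j'` is a successor `k+1`, and separating the pivot coordinate
   `v_k` (`Fin.insertNthEquiv`) the condition reads `a_i a_{i'} (±v_k) + Δ₀ ≡ 0 (mod p)` with `Δ₀`
   independent of `v_k`, which has exactly one solution `v_k ∈ [0, p)` (`card_filter_range_dvd_linear`).

References: P. X. Gallagher, Mathematika 23 (1976), §2 p. 7 [Gallagher1976]; B. Green, T. Tao,
Ann. of Math. 171 (2010), (1.6) and Lemma 1.3 [GreenTao2010].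
-/

noncomputable section

open scoped BigOperators Classical Topology
open Finset Filter MeasureTheory Literature.NumberTheory.Sieve
open Summit.Parity.GeneralizedHardyLittlewood.Cruxes.RelativeDimOne.TranslateAmplification

namespace Summit.Parity.GeneralizedHardyLittlewood.Cruxes.AbsoluteUpgrade.UniformAmplification

variable {t m : ℕ}

/-! ### Step 1: the Chinese remainder theorem in product form -/

/-- Chinese remainder theorem, product form (Gallagher p. 7): for a finite set `R` of primes with
product `P` and weights `g_p` on `ℕ^m`, each depending only on its argument modulo `p`,
`∑_{u ∈ [0, P)^m} ∏_{p ∈ R} g_p(u) = ∏_{p ∈ R} ∑_{v ∈ [0, p)^m} g_p(v)`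
(induction on `R`; the fibres of reduction modulo `∏ R'` are handled by
`Gallagher.sum_filter_modVec_eq`). [cite: Gallagher1976, Section 2] -/
theorem sum_prod_eq_prod_sum_of_periodic (m : ℕ) (R : Finset ℕ) (hR : ∀ p ∈ R, p.Prime)
    (g : ℕ → (Fin m → ℕ) → ℝ) (hg : ∀ p ∈ R, ∀ u, g p (Gallagher.modVec p u) = g p u) :
    ∑ u ∈ Fintype.piFinset (fun _ : Fin m => range (∏ p ∈ R, p)), ∏ p ∈ R, g p u =
      ∏ p ∈ R, ∑ v ∈ Fintype.piFinset (fun _ : Fin m => range p), g p v := by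
  induction R using Finset.induction_on with
  | empty => simp
  | insert p S hpS ih =>
    have hp : p.Prime := hR p (mem_insert_self _ _)
    have hS' : ∀ q ∈ S, q.Prime := fun q hq => hR q (mem_insert_of_mem hq)
    have hgS : ∀ q ∈ S, ∀ u, g q (Gallagher.modVec q u) = g q u :=
      fun q hq => hg q (mem_insert_of_mem hq)
    have ih' := ih hS' hgS
    have hP'pos : 0 < ∏ q ∈ S, q := Finset.prod_pos fun q hq => (hS' q hq).pos
    have hcop : Nat.Coprime p (∏ q ∈ S, q) :=
      Nat.Coprime.prod_right fun q hq =>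
        (Nat.coprime_primes hp (hS' q hq)).2 fun h => hpS (h ▸ hq)
    rw [Finset.prod_insert hpS, Finset.prod_insert hpS]
    simp_rw [Finset.prod_insert hpS]
    have hmaps : ∀ r ∈ Fintype.piFinset (fun _ : Fin m => range (p * ∏ q ∈ S, q)),
        Gallagher.modVec (∏ q ∈ S, q) r ∈
          Fintype.piFinset (fun _ : Fin m => range (∏ q ∈ S, q)) :=
      fun r _ => Fintype.mem_piFinset.2 fun j => mem_range.2 (Nat.mod_lt _ hP'pos)
    rw [← Finset.sum_fiberwise_of_maps_to hmaps]
    -- the weights `g q`, `q ∈ S`, are periodic modulo `∏ S`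
    have hgP : ∀ q ∈ S, ∀ r : Fin m → ℕ, g q (Gallagher.modVec (∏ q ∈ S, q) r) = g q r := by
      intro q hq r
      rw [← hgS q hq (Gallagher.modVec _ r), ← hgS q hq r]
      congr 1
      funext j
      simp only [Gallagher.modVec_apply]
      exact Nat.mod_mod_of_dvd _ (Finset.dvd_prod_of_mem _ hq)
    have hinner : ∀ u ∈ Fintype.piFinset (fun _ : Fin m => range (∏ q ∈ S, q)),
        ∑ r ∈ (Fintype.piFinset fun _ : Fin m => range (p * ∏ q ∈ S, q)).filter
            (fun r => Gallagher.modVec (∏ q ∈ S, q) r = u),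
          g p r * ∏ q ∈ S, g q r =
          (∑ v ∈ Fintype.piFinset (fun _ : Fin m => range p), g p v) * ∏ q ∈ S, g q u := by
      intro u hu
      have hF : ∀ r ∈ (Fintype.piFinset fun _ : Fin m => range (p * ∏ q ∈ S, q)).filter
          (fun r => Gallagher.modVec (∏ q ∈ S, q) r = u),
          ∏ q ∈ S, g q r = ∏ q ∈ S, g q u := by
        intro r hr
        rw [← (mem_filter.1 hr).2]
        exact Finset.prod_congr rfl fun q hq => (hgP q hq r).symm
      rw [Finset.sum_congr rfl fun r hr => by rw [hF r hr], ← Finset.sum_mul,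
        Gallagher.sum_filter_modVec_eq hp.pos hP'pos hcop (g p) (hg p (mem_insert_self _ _)) hu]
    rw [Finset.sum_congr rfl hinner, ← Finset.mul_sum, ih']

/-! ### Step 2: periodicity of the collision conditions -/

/-- The collision form `Δ_{j,j',i,i'}(H) = a_i a_{i'} (H'_j − H'_{j'}) + (a_{i'} b_i − a_i b_{i'})` is
integer-affine in the shift, hence depends on `H` only modulo `n`, coordinatewise. [folklore] -/
theorem collisionForm_modEq (Ψ : Fin t → AffLinForm 1) {n : ℤ} {H H' : Fin m → ℤ}
    (h : ∀ k, H k ≡ H' k [ZMOD n]) (j j' : Fin (m + 1)) (i i' : Fin t) :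
    collisionForm Ψ H j j' i i' ≡ collisionForm Ψ H' j j' i i' [ZMOD n] := by
  have hs : ∀ l : Fin (m + 1), shiftVec H l ≡ shiftVec H' l [ZMOD n] := by
    intro l
    refine Fin.cases ?_ (fun k => ?_) l
    · simp only [shiftVec_zero]
      exact Int.ModEq.refl _
    · simp only [shiftVec_succ]
      exact h k
  unfold collisionForm
  exact (((hs j).sub (hs j')).mul_left _).add_right _

/-- The collision indicator `1[p ∣ Δ_{j,j',i,i'}(H)]` depends on `H` only modulo `p`,
coordinatewise. [folklore] -/
theorem collisionIndicator_congr (Ψ : Fin t → AffLinForm 1) {n : ℤ} {H H' : Fin m → ℤ}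
    (h : ∀ k, H k ≡ H' k [ZMOD n]) (j j' : Fin (m + 1)) (i i' : Fin t) :
    (if n ∣ collisionForm Ψ H j j' i i' then (1 : ℝ) else 0) =
      if n ∣ collisionForm Ψ H' j j' i i' then (1 : ℝ) else 0 :=
  if_congr (collisionForm_modEq Ψ h j j' i i').dvd_iff rfl rfl

/-! ### Step 3: counting the solutions of one collision condition -/

/-- A linear congruence `c x + d ≡ 0 (mod p)` with `p` prime and `p ∤ c` has exactly one solution
`x ∈ [0, p)`. [folklore] -/
theorem card_filter_range_dvd_linear {p : ℕ} (hp : p.Prime) {c : ℤ} (hc : ¬ (p : ℤ) ∣ c) (d : ℤ) :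
    #((range p).filter fun x : ℕ => (p : ℤ) ∣ c * x + d) = 1 := by
  haveI := Fact.mk hp
  have hc' : (c : ZMod p) ≠ 0 := fun h => hc ((ZMod.intCast_zmod_eq_zero_iff_dvd _ _).1 h)
  rw [Finset.card_eq_one]
  refine ⟨(-(d : ZMod p) / (c : ZMod p)).val, ?_⟩
  ext x
  simp only [mem_filter, mem_range, mem_singleton]
  constructor
  · rintro ⟨hx, hdvd⟩
    have h1 : ((c * x + d : ℤ) : ZMod p) = 0 := (ZMod.intCast_zmod_eq_zero_iff_dvd _ _).2 hdvd
    push_cast at h1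
    have h2 : (x : ZMod p) = -(d : ZMod p) / (c : ZMod p) := by
      rw [eq_div_iff hc']
      linear_combination h1
    have h3 := congrArg ZMod.val h2
    rwa [ZMod.val_natCast, Nat.mod_eq_of_lt hx] at h3
  · rintro rfl
    refine ⟨ZMod.val_lt _, ?_⟩
    rw [← ZMod.intCast_zmod_eq_zero_iff_dvd]
    push_cast
    rw [ZMod.natCast_zmod_val]
    field_simp
    ring

/-- Separating a pivot coordinate `k`: the shift vector of `insertNth k x w` exceeds that of
`insertNth k 0 w` by `x` in the coordinate `k + 1` and agrees with it elsewhere. [folklore] -/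
theorem shiftVec_insertNth {n : ℕ} (k : Fin (n + 1)) (x : ℕ) (w : Fin n → ℕ) (l : Fin (n + 2)) :
    shiftVec (fun i => ((Fin.insertNth (α := fun _ => ℕ) k x w i : ℕ) : ℤ)) l =
      shiftVec (fun i => ((Fin.insertNth (α := fun _ => ℕ) k 0 w i : ℕ) : ℤ)) l +
        (if l = k.succ then (1 : ℤ) else 0) * x := by
  refine Fin.cases ?_ (fun i => ?_) l
  · simp only [shiftVec_zero, if_neg (Fin.succ_ne_zero k).symm, zero_mul, add_zero]
  · rw [shiftVec_succ, shiftVec_succ]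
    rcases eq_or_ne i k with rfl | hik
    · simp
    · obtain ⟨z, rfl⟩ := Fin.exists_succAbove_eq hik
      simp [Fin.insertNth_apply_succAbove, Fin.succAbove_ne]

/-- Pivot count: if an integer-valued function `D` on `ℕ^{n+1}` is affine in the pivot coordinate
`k` with a slope `c` invertible modulo the prime `p`, `D(insertNth k x w) = c x + D(insertNth k 0 w)`,
then `p ∣ D(v)` has exactly `p^n` solutions `v ∈ [0, p)^{n+1}` (one per value of the remaining
coordinates). [folklore] -/
theorem sum_indicator_dvd_of_pivot {n p : ℕ} (hp : p.Prime) (k : Fin (n + 1))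
    (D : (Fin (n + 1) → ℕ) → ℤ) {c : ℤ} (hc : ¬ (p : ℤ) ∣ c)
    (hD : ∀ (x : ℕ) (w : Fin n → ℕ), D (Fin.insertNth (α := fun _ => ℕ) k x w) =
      c * x + D (Fin.insertNth (α := fun _ => ℕ) k 0 w)) :
    ∑ v ∈ Fintype.piFinset (fun _ : Fin (n + 1) => range p),
        (if (p : ℤ) ∣ D v then (1 : ℝ) else 0) = (p : ℝ) ^ n := by
  have hsum : ∑ xw ∈ range p ×ˢ Fintype.piFinset (fun _ : Fin n => range p),
      (if (p : ℤ) ∣ D (Fin.insertNth (α := fun _ => ℕ) k xw.1 xw.2) then (1 : ℝ) else 0) =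
      ∑ v ∈ Fintype.piFinset (fun _ : Fin (n + 1) => range p),
        (if (p : ℤ) ∣ D v then (1 : ℝ) else 0) := by
    refine Finset.sum_equiv (Fin.insertNthEquiv (fun _ => ℕ) k) (fun xw => ?_) (fun xw _ => rfl)
    have he : (Fin.insertNthEquiv (fun _ => ℕ) k) xw = Fin.insertNth (α := fun _ => ℕ) k xw.1 xw.2 :=
      rfl
    rw [Finset.mem_product, he, Fin.mem_piFinset_iff_pivot_removeNth k, Fin.insertNth_apply_same,
      Fin.removeNth_insertNth]
    rfl
  rw [← hsum, Finset.sum_product_right]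
  have hinner : ∀ w ∈ Fintype.piFinset (fun _ : Fin n => range p),
      ∑ x ∈ range p,
          (if (p : ℤ) ∣ D (Fin.insertNth (α := fun _ => ℕ) k x w) then (1 : ℝ) else 0) = 1 := by
    intro w _
    have hx : ∀ x ∈ range p,
        (if (p : ℤ) ∣ D (Fin.insertNth (α := fun _ => ℕ) k x w) then (1 : ℝ) else 0) =
          if (p : ℤ) ∣ c * x + D (Fin.insertNth (α := fun _ => ℕ) k 0 w) then (1 : ℝ) else 0 := by
      intro x _
      rw [hD x w]
    rw [Finset.sum_congr rfl hx, Finset.sum_boole, card_filter_range_dvd_linear hp hc, Nat.cast_one]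
  rw [Finset.sum_congr rfl hinner, Finset.sum_const, nsmul_eq_mul, mul_one,
    Fintype.card_piFinset_const, card_range, Nat.cast_pow]

/-- One collision condition at a prime `p` not dividing the leading coefficients cuts `[0, p)^m` down
by exactly the factor `p`: for `j ≠ j'`, `#{v ∈ [0, p)^m : p ∣ Δ_{j,j',i,i'}(v)} = p^m / p` (one of
`j, j'` is a successor `k + 1`; in the pivot coordinate `v_k` the condition is a linear congruence with
slope `± a_i a_{i'}`). [folklore] -/
theorem sum_collisionIndicator (Ψ : Fin t → AffLinForm 1) {p : ℕ} (hp : p.Prime)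
    {j j' : Fin (m + 1)} (hjj : j ≠ j') {i i' : Fin t} (hi : ¬ (p : ℤ) ∣ (Ψ i).coeff 0)
    (hi' : ¬ (p : ℤ) ∣ (Ψ i').coeff 0) :
    ∑ v ∈ Fintype.piFinset (fun _ : Fin m => range p),
        (if (p : ℤ) ∣ collisionForm Ψ (fun l => (v l : ℤ)) j j' i i' then (1 : ℝ) else 0) =
      (p : ℝ) ^ m / p := by
  obtain ⟨n, rfl⟩ : ∃ n, m = n + 1 := by
    cases m with
    | zero => exact absurd (Fin.ext (by have h1 := j.isLt; have h2 := j'.isLt; omega)) hjj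
    | succ n => exact ⟨n, rfl⟩
  -- a pivot coordinate `k`: exactly one of `j`, `j'` equals `k + 1`
  obtain ⟨k, hk⟩ : ∃ k : Fin (n + 1), (j = k.succ ∧ j' ≠ k.succ) ∨ (j' = k.succ ∧ j ≠ k.succ) := by
    rcases eq_or_ne j 0 with hj0 | hj0
    · have hj'0 : j' ≠ 0 := fun h => hjj (hj0.trans h.symm)
      refine ⟨j'.pred hj'0, Or.inr ⟨(Fin.succ_pred j' hj'0).symm, ?_⟩⟩
      rw [Fin.succ_pred]
      exact hjj
    · refine ⟨j.pred hj0, Or.inl ⟨(Fin.succ_pred j hj0).symm, ?_⟩⟩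
      rw [Fin.succ_pred]
      exact hjj.symm
  have hpz : Prime (p : ℤ) := Nat.prime_iff_prime_int.mp hp
  have hcc : ¬ (p : ℤ) ∣ (Ψ i).coeff 0 * (Ψ i').coeff 0 := fun h =>
    (hpz.dvd_or_dvd h).elim hi hi'
  -- the slope of `Δ` in the pivot coordinate is `± a_i a_{i'}`
  set σ : ℤ := (if j = k.succ then (1 : ℤ) else 0) - (if j' = k.succ then (1 : ℤ) else 0) with hσ
  have hσ' : σ = 1 ∨ σ = -1 := by
    rcases hk with ⟨h1, h2⟩ | ⟨h1, h2⟩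
    · refine Or.inl ?_
      rw [hσ, if_pos h1, if_neg h2]
      norm_num
    · refine Or.inr ?_
      rw [hσ, if_neg h2, if_pos h1]
      norm_num
  have hc : ¬ (p : ℤ) ∣ (Ψ i).coeff 0 * (Ψ i').coeff 0 * σ := by
    rcases hσ' with e | e
    · rw [e, mul_one]
      exact hcc
    · rw [e, mul_neg_one, dvd_neg]
      exact hcc
  have hD : ∀ (x : ℕ) (w : Fin n → ℕ),
      collisionForm Ψ (fun l => ((Fin.insertNth (α := fun _ => ℕ) k x w l : ℕ) : ℤ)) j j' i i' =
        (Ψ i).coeff 0 * (Ψ i').coeff 0 * σ * x +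
          collisionForm Ψ (fun l => ((Fin.insertNth (α := fun _ => ℕ) k 0 w l : ℕ) : ℤ))
            j j' i i' := by
    intro x w
    simp only [collisionForm, shiftVec_insertNth k x w, hσ]
    ring
  rw [sum_indicator_dvd_of_pivot hp k (fun v => collisionForm Ψ (fun l => (v l : ℤ)) j j' i i')
      hc hD, pow_succ, mul_div_cancel_right₀ _ (by exact_mod_cast hp.ne_zero : (p : ℝ) ≠ 0)]

/-! ### Step 4: assembly (the stub) -/

/-- **B holds** (`CondLocalAverage`, Gallagher's exact Chinese-remainder average with collision
conditions): for disjoint finite sets of primes `S`, `Q`, an assignment `α` of a collision index with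
distinct translate indices to every prime of `Q` (primes of `Q` not dividing the leading coefficients),
and any integer box of side `∏_{S ∪ Q} p`,
`∑_{H ∈ box} (∏_{p ∈ S} β_p(Ψ^{(H)})) ∏_{p ∈ Q} 1[p ∣ Δ_{α(p)}(H)] = (∏_{S∪Q} p)^m (∏_{p ∈ S} β_p(Ψ)^{m+1}) / ∏_Q p`.
[cite: Gallagher1976, Section 2] -/
theorem stub_condLocalAverage : CondLocalAverage := by
  intro m t Ψ S Q hS hQ hSQ α hα hcoef a
  have hSQp : ∀ p ∈ S ∪ Q, p.Prime := fun p hp => (mem_union.1 hp).elim (hS p) (hQ p)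
  have hPpos : 0 < ∏ p ∈ S ∪ Q, p := Finset.prod_pos fun p hp => (hSQp p hp).pos
  have hPZ : (∏ p ∈ S ∪ Q, (p : ℤ)) = ((∏ p ∈ S ∪ Q, p : ℕ) : ℤ) := by push_cast; rfl
  -- periodicity of the summand modulo `∏ (S ∪ Q)`
  have hper : ∀ H H' : Fin m → ℤ, (∀ j, H j ≡ H' j [ZMOD ((∏ p ∈ S ∪ Q, p : ℕ) : ℤ)]) →
      (∏ p ∈ S, localFactor (translateFamily Ψ H) p) *
          ∏ p ∈ Q, (if (p : ℤ) ∣ collisionForm Ψ H (α p).1.1 (α p).1.2 (α p).2.1 (α p).2.2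
            then (1 : ℝ) else 0) =
        (∏ p ∈ S, localFactor (translateFamily Ψ H') p) *
          ∏ p ∈ Q, (if (p : ℤ) ∣ collisionForm Ψ H' (α p).1.1 (α p).1.2 (α p).2.1 (α p).2.2
            then (1 : ℝ) else 0) := by
    intro H H' h
    have hdvd : ∀ p ∈ S ∪ Q, ∀ j, H j ≡ H' j [ZMOD (p : ℕ)] := fun p hp j =>
      (h j).of_dvd (Int.natCast_dvd_natCast.2 (Finset.dvd_prod_of_mem _ hp))
    congr 1
    · exact Finset.prod_congr rfl fun p hp =>
        localFactor_translateFamily_congr Ψ (hdvd p (mem_union_left Q hp))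
    · exact Finset.prod_congr rfl fun p hp =>
        collisionIndicator_congr Ψ (hdvd p (mem_union_right S hp)) _ _ _ _
  rw [hPZ]
  refine (sum_box_eq_sum_range_of_periodic hPpos _ hper a).trans ?_
  -- the Chinese-remainder weights: `β_p(Ψ^{(u)})` for `p ∈ S`, the collision indicator otherwise
  set g : ℕ → (Fin m → ℕ) → ℝ := fun p u =>
      if p ∈ S then localFactor (translateFamily Ψ fun j => (u j : ℤ)) p
      else if (p : ℤ) ∣ collisionForm Ψ (fun j => (u j : ℤ)) (α p).1.1 (α p).1.2 (α p).2.1 (α p).2.2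
        then 1 else 0
    with hg
  -- on `ℕ^m` the summand is the product over `S ∪ Q` of the Chinese-remainder weights
  have hFg : ∀ u ∈ Fintype.piFinset (fun _ : Fin m => range (∏ p ∈ S ∪ Q, p)),
      (∏ p ∈ S, localFactor (translateFamily Ψ fun j => (u j : ℤ)) p) *
          ∏ p ∈ Q, (if (p : ℤ) ∣ collisionForm Ψ (fun j => (u j : ℤ)) (α p).1.1 (α p).1.2
              (α p).2.1 (α p).2.2 then (1 : ℝ) else 0) =
        ∏ p ∈ S ∪ Q, g p u := by
    intro u _
    rw [Finset.prod_union hSQ]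
    congr 1
    · exact Finset.prod_congr rfl fun p hp => by simp only [hg, hp, if_true]
    · exact Finset.prod_congr rfl fun p hp => by
        simp only [hg, Finset.disjoint_right.1 hSQ hp, if_false]
  -- the weights are periodic
  have hgper : ∀ p ∈ S ∪ Q, ∀ u, g p (Gallagher.modVec p u) = g p u := by
    intro p _ u
    have hmod : ∀ j, ((Gallagher.modVec p u j : ℕ) : ℤ) ≡ (u j : ℤ) [ZMOD (p : ℕ)] := fun j => by
      rw [Gallagher.modVec_apply, Int.natCast_mod]
      exact Int.mod_modEq _ _
    by_cases hpS : p ∈ S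
    · simp only [hg, hpS, if_true]
      exact localFactor_translateFamily_congr Ψ hmod
    · simp only [hg, hpS, if_false]
      exact collisionIndicator_congr Ψ hmod _ _ _ _
  rw [Finset.sum_congr rfl hFg, sum_prod_eq_prod_sum_of_periodic m (S ∪ Q) hSQp g hgper,
    Finset.prod_union hSQ]
  -- the factors
  have hSfac : ∀ p ∈ S, ∑ v ∈ Fintype.piFinset (fun _ : Fin m => range p), g p v =
      (p : ℝ) ^ m * localFactor Ψ p ^ (m + 1) := by
    intro p hp
    simp only [hg, hp, if_true]
    exact sum_localFactor_translateFamily Ψ (hS p hp).pos m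
  have hQfac : ∀ p ∈ Q, ∑ v ∈ Fintype.piFinset (fun _ : Fin m => range p), g p v =
      (p : ℝ) ^ m / p := by
    intro p hp
    simp only [hg, Finset.disjoint_right.1 hSQ hp, if_false]
    exact sum_collisionIndicator Ψ (hQ p hp) (hα p hp) (hcoef p hp _) (hcoef p hp _)
  rw [Finset.prod_congr rfl hSfac, Finset.prod_congr rfl hQfac]
  simp only [Finset.prod_mul_distrib, Finset.prod_div_distrib, Finset.prod_pow]
  push_cast
  rw [Finset.prod_union hSQ, mul_pow]
  ring

end Summit.Parity.GeneralizedHardyLittlewood.Cruxes.AbsoluteUpgrade.UniformAmplification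

end
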